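import Summits.BirchSwinnertonDyer.BirchSwinnertonDyer.Theses.TwistFamilyManinDescent
import Literature.NumberTheory.EllipticCurves.ModularCurveManinConstantProofs

/-!
# Ordinary CM torsor — the Eisenstein–Manin identity ★ as a typed dictionary (crux stmt-BirchSwinnertonDyer-25138,
crux-ideate seat 1, g13; companion of `OrdinaryCMTorsorSketch.lean`, note `Ideas/ordinary-cm-torsor-eisenstein.md`)

On an ordinary Case-A row (`E` optimal, `N = p²M`, `p ≥ 5`, `12/gcd(12,v_p Δ) ∣ p − 1`, rational `p`-line étale at `p`,
its image `ι(C) ⊂ J₀(N)[p]` cuspidal with generator divisor `D_S`) Theorem ★ of the note reads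

  `v_π(p · a₁(E_{D_S})) = b + (p − 1) · v_p(c(E))`   (`π = ζ_p − 1`, `v_π(p) = p − 1`, `1 ≤ b ≤ p − 2` the digit
  `cwIndex`), where `E_{D_S}` is the weight-2 Eisenstein series on `Γ₀(N)` with residual divisor `D_S`.

Hence NV″ (`a₁(E_{D_S})` not `p`-integral, i.e. `v_π(p a₁) < p − 1`) ⟺ `p ∤ c(E)`.  This file posits ★ as the single
field of an interface `EisensteinTorsorDatum D p` (its CONSTRUCTION — Kummer theory of the `μ_p`-torsor `g_S^{1/p}`
on the ordinary Tate neighbourhood, `B̂ ≅ Ĝ_m` over `ℤ_p[ζ_p]^nr`, Weierstrass preparation — is the line's stub, not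
a field) and kernel-checks the equivalence `NVpp ↔ ¬ p ∣ c` and the crux-facing link.  E-free side: `b`, `vpa1`
(cuspidal group + Eisenstein q-expansion at `∞`); E-side: `D.maninConstant` only.

BSD is not proved by this; Manin `c = 1` is not proved by this.
-/

namespace Summit.BirchSwinnertonDyer.BirchSwinnertonDyer.Cruxes.EisensteinAdditiveManinResidual.OrdinaryCMTorsor

open Literature.NumberTheory.EllipticCurves.ModularForms

variable {N : ℕ} [NeZero N] {W : WeierstrassCurve ℚ} [W.IsElliptic]

/-- POSITED INTERFACE (construction = stub S★ of the line): the cuspidal Eisenstein torsor datum of an ordinary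
Case-A row.  `b` = the Coates–Wiles digit `cwIndex = (p−1)·v_p(Δ)/12 ∈ [1, p−2]`; `vpa1` = normalised `π`-adic
valuation of `p · a₁(E_{D_S})` (`⊤` if it vanishes); `star` = Theorem ★. -/
structure EisensteinTorsorDatum (D : ModularParametrizationData W N) (p : ℕ) where
  /-- the digit `b = cwIndex` -/
  b : ℕ
  one_le_b : 1 ≤ b
  b_add_two_le : b + 2 ≤ p
  /-- `v_π(p · a₁(E_{D_S}))` on the scale `v_π(p) = p − 1` -/
  vpa1 : ℕ∞
  /-- Theorem ★: `v_π(p a₁(E_{D_S})) = b + (p−1)·v_p(c)` -/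
  star : vpa1 = (b : ℕ∞) + ((p - 1 : ℕ) : ℕ∞) * emultiplicity (p : ℤ) D.maninConstant

namespace EisensteinTorsorDatum

variable {D : ModularParametrizationData W N} {p : ℕ}

/-- NV″: the Eisenstein series `E_{D_S}` is NOT `p`-integral at `∞` (`a₁ ∉ ℤ_p[ζ_p]` ⟺ `v_π(p a₁) < v_π(p) = p − 1`). -/
def NVpp (T : EisensteinTorsorDatum D p) : Prop := T.vpa1 < ((p - 1 : ℕ) : ℕ∞)

/-- ★ ⇒ (NV″ ⟺ `p ∤ c`). -/
theorem nvpp_iff_not_dvd (T : EisensteinTorsorDatum D p) :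
    T.NVpp ↔ ¬ (p : ℤ) ∣ D.maninConstant := by
  unfold NVpp
  rw [T.star]
  constructor
  · intro h hdvd
    have hm : emultiplicity (p : ℤ) D.maninConstant ≠ 0 := by
      rw [Ne, emultiplicity_eq_zero]; exact fun h' => h' hdvd
    have h1 : (1 : ℕ∞) ≤ emultiplicity (p : ℤ) D.maninConstant := Order.one_le_iff_ne_zero.mpr hm
    have h2 : ((p - 1 : ℕ) : ℕ∞) ≤ ((p - 1 : ℕ) : ℕ∞) * emultiplicity (p : ℤ) D.maninConstant := by
      calc ((p - 1 : ℕ) : ℕ∞) = ((p - 1 : ℕ) : ℕ∞) * 1 := (mul_one _).symm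
        _ ≤ ((p - 1 : ℕ) : ℕ∞) * emultiplicity (p : ℤ) D.maninConstant := mul_le_mul_left' h1 _
    have h3 : ((p - 1 : ℕ) : ℕ∞) ≤ (T.b : ℕ∞) + ((p - 1 : ℕ) : ℕ∞) * emultiplicity (p : ℤ) D.maninConstant :=
      le_add_left h2
    exact absurd h (not_lt.mpr h3)
  · intro hndvd
    have hm : emultiplicity (p : ℤ) D.maninConstant = 0 := emultiplicity_eq_zero.mpr hndvd
    rw [hm, mul_zero, add_zero]
    have : T.b < p - 1 := by have := T.b_add_two_le; omega
    exact_mod_cast this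

/-- the exact digit when `p ∤ c`: `v_π(p a₁(E_{D_S})) = b`. -/
theorem vpa1_eq_b_of_not_dvd (T : EisensteinTorsorDatum D p) (h : ¬ (p : ℤ) ∣ D.maninConstant) :
    T.vpa1 = T.b := by
  rw [T.star, emultiplicity_eq_zero.mpr h, mul_zero, add_zero]

/-- `p ∣ c` forces `p`-integrality of `a₁(E_{D_S})` (the killable prediction of ★ on Case-A rows). -/
theorem not_nvpp_of_dvd (T : EisensteinTorsorDatum D p) (h : (p : ℤ) ∣ D.maninConstant) : ¬ T.NVpp :=
  fun h' => (T.nvpp_iff_not_dvd.mp h') h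

end EisensteinTorsorDatum

/-- The NV″-LAW as the line would file it (E-free conclusion `T.NVpp`; the crux hypotheses verbatim; the datum's
existence is stub S★ + I9 (Case A) + K1 (cuspidality); rows outside the ordinary Case-A range need the other levers,
so the law is stated as "a datum with NV″ exists OR `p ∤ c` is known otherwise"). -/
def NVppLaw : Prop :=
  ∀ (W : WeierstrassCurve ℚ) [W.IsElliptic] [W.IsGloballyMinimal] {N : ℕ} [NeZero N]
    (D : ModularParametrizationData W N) (p : ℕ) (hp : p.Prime),
    (p = 5 ∨ p = 7 ∨ p = 13 ∨ (p = 163 ∧ 2 ^ 6 ∣ N)) → p ^ 2 ∣ N → ¬ W.HasIrreducibleModPGaloisRep p →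
    ¬ ((W.quadraticTwist (((-1 : ℤ) ^ (p / 2) * p : ℤ) : ℚ)).HasGoodReductionAt
          ((Rat.HeightOneSpectrum.primesEquiv (R := ℤ)).symm ⟨p, hp⟩) ∨
        (W.quadraticTwist (((-1 : ℤ) ^ (p / 2) * p : ℤ) : ℚ)).HasMultiplicativeReductionAt
          ((Rat.HeightOneSpectrum.primesEquiv (R := ℤ)).symm ⟨p, hp⟩)) →
    (∀ z ∈ D.L.lattice, ∃ w ∈ periodLattice D.f, z = D.c * w) →
    (∃ T : EisensteinTorsorDatum D p, T.NVpp) ∨ ¬ (p : ℤ) ∣ D.maninConstant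

/-- **Proved link:** `NVppLaw → EisensteinAdditiveManinResidual` (stmt-25138). -/
theorem crux_of_nvppLaw (h : NVppLaw) :
    Theses.TwistFamilyManinDescent.EisensteinAdditiveManinResidual := by
  intro _ _ _ _ W _ _ N _ D p hp hrow hN hred htw hopt
  rcases h W D p hp hrow hN hred htw hopt with ⟨T, hT⟩ | hc
  · exact T.nvpp_iff_not_dvd.mp hT
  · exact hc

/-- Row table (kernel-checked): the ordinary rows among the crux rows `p ∈ {5,7,13}`, `0 < v < 12`, `12 ∤ v·(...)`:
`(p, v) ↦ (e_E, b)` with `e_E = 12/gcd(12,v) ∣ p − 1`, `b = (p−1)v/12`.  For `p = 5`: `v ∈ {3,9}` (III, III*; e = 4;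
b = 1, 3); `p = 7`: `v ∈ {2,4,8,10}` (II, IV, IV*, II*; e = 6, 3, 3, 6; b = 1,2,4,5); `p = 13`: every `v`. -/
def ordinaryRows : List (ℕ × ℕ × ℕ × ℕ) :=
  ((List.range 12).filterMap fun v =>
      if v = 0 then none else
      let e := 12 / Nat.gcd 12 v
      if e = 1 ∨ e = 2 then none else if (5 - 1) % e = 0 then some (5, v, e, 4 * v / 12) else none) ++
  ((List.range 12).filterMap fun v =>
      if v = 0 then none else
      let e := 12 / Nat.gcd 12 v
      if e = 1 ∨ e = 2 then none else if (7 - 1) % e = 0 then some (7, v, e, 6 * v / 12) else none)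

theorem ordinaryRows_eq :
    ordinaryRows = [(5, 3, 4, 1), (5, 9, 4, 3), (7, 2, 6, 1), (7, 4, 3, 2), (7, 8, 3, 4), (7, 10, 6, 5)] := by
  decide

end Summit.BirchSwinnertonDyer.BirchSwinnertonDyer.Cruxes.EisensteinAdditiveManinResidual.OrdinaryCMTorsor
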